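import Summits.QuantumFields.GaugeBoot.BootstrapCertificateTransport
import HarnessLib

/-!
# Affine pencils of subspaces `β ↦ range (L₀ - β L₁)`: generic dimension off a finite set, and a finite-rank regulariser at points of maximal dimension (gauge-boot, L1/L4 supplement)

HONEST FRAMING (cell `pub-gaugeboot`, page 1 of every file): the venture produces certified bounds
on lattice expectations at stated coupling, gauge group, dimension and torus size; NOT a mass gap,
NOT a continuum limit, NOT a string tension; NOT Yang–Mills-summit-bearing (barriers
`FixedCouplingUltralocality`, `PerturbativeInvisibility`). Pure linear algebra; it certifies no
number.

## Content (the row-space half of "the level-`n` SDP value is continuous in `β` off a finite set")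

The level-`n` loop-equation rows of the lattice bootstrap are `f' - β • (f S')`: the row space at
coupling `β` is the image `R(β) = range (L₀ - β • L₁)` of a FIXED finite-dimensional space of pairs
under an affine pencil of linear maps. For such a pencil (`M` finite-dimensional, `E` arbitrary):

* `pencilRange L₀ L₁ β`, `maxRank L₀ L₁` (the maximal dimension of `R(β)` over `β ∈ ℝ`, attained:
  `exists_finrank_eq_maxRank`);
* ★★ `finite_setOf_finrank_ne_maxRank` — `dim R(β) = maxRank` for all but FINITELY many `β` (a
  `maxRank × maxRank` minor of the pencil, normalised to the identity at a point of maximal rank,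
  has polynomial determinant with finitely many zeros);
* ★★ `exists_regulariser` — at every `β₀` with `dim R(β₀) = maxRank` there are finitely many
  linear functionals `π_i` on `E` and curves `g_i : ℝ → E` with: `Σ_i π_i(x) g_i(β) = x` for all
  `x ∈ R(β)` and all `β` near `β₀` (a projection onto `R(β)` varying continuously), `g_i(β₀) ∈ R(β₀)`,
  and `β ↦ φ (g_i β)` continuous at `β₀` for every linear `φ` (Cramer: inverse of a matrix with
  affine entries and determinant `1` at `β₀`). This is the "regular rows" input of
  `ConicFeasibleStability.inner_semicontinuous`.

References: F. R. Gantmacher, The Theory of Matrices, Vol. II, Ch. XII (pencils of matrices);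
J. F. Bonnans, A. Shapiro, Perturbation Analysis of Optimization Problems (2000) Ch. 4. Folklore.
-/

noncomputable section

open Filter Topology Matrix Polynomial

namespace Summit.QuantumFields.GaugeBoot.RowPencil

variable {M E : Type*} [AddCommGroup M] [Module ℝ M] [AddCommGroup E] [Module ℝ E]
  (L₀ L₁ : M →ₗ[ℝ] E)

/-- **The pencil of subspaces** `R(β) = range (L₀ - β • L₁)`. [folklore] -/
def pencilRange (β : ℝ) : Submodule ℝ E := LinearMap.range (L₀ - β • L₁)

/-- **The maximal dimension of the pencil** (meaningful for finite-dimensional `M`). [folklore] -/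
def maxRank : ℕ := sSup (Set.range fun β : ℝ => Module.finrank ℝ (pencilRange L₀ L₁ β))

/-! ## A frame of `R(β₀)` transported along the pencil -/

/-- **A transported frame at `β₀`**: vectors `v_i ∈ M` whose images at `β₀` form a basis of
`R(β₀)`; `Ψ β c = (L₀ - β L₁)(Σ c_i v_i)`; a linear left inverse `lam` of `Ψ β₀`. [folklore] -/
structure Frame (β₀ : ℝ) where
  /-- the rank at `β₀` -/
  ρ : ℕ
  /-- preimages of a basis of `R(β₀)` -/
  v : Fin ρ → M
  /-- a linear left inverse of `Ψ β₀` -/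
  lam : E →ₗ[ℝ] (Fin ρ → ℝ)
  /-- the rank is the dimension -/
  finrank_eq : Module.finrank ℝ (pencilRange L₀ L₁ β₀) = ρ
  /-- left inverse property -/
  lam_comp : lam ∘ₗ ((L₀ - β₀ • L₁) ∘ₗ Fintype.linearCombination ℝ v) = LinearMap.id

variable {L₀ L₁}

namespace Frame

variable {β₀ : ℝ} (F : Frame L₀ L₁ β₀)

/-- `Ψ β : ℝ^ρ → E`, `c ↦ (L₀ - β L₁)(Σ c_i v_i)`. -/
def Ψ (β : ℝ) : (Fin F.ρ → ℝ) →ₗ[ℝ] E := (L₀ - β • L₁) ∘ₗ Fintype.linearCombination ℝ F.v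

/-- `Ψ β` is affine in `β`. -/
theorem Ψ_eq (β : ℝ) :
    F.Ψ β = L₀ ∘ₗ Fintype.linearCombination ℝ F.v - β • (L₁ ∘ₗ Fintype.linearCombination ℝ F.v) := by
  rw [Ψ, LinearMap.sub_comp, LinearMap.smul_comp]

/-- `range (Ψ β) ≤ R(β)`. -/
theorem range_Ψ_le (β : ℝ) : LinearMap.range (F.Ψ β) ≤ pencilRange L₀ L₁ β := by
  rw [Ψ, LinearMap.range_comp]
  exact LinearMap.map_le_range

/-- The matrix `M(β)` of `lam ∘ Ψ β`; `M(β₀) = 1`. -/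
def mat (β : ℝ) : Matrix (Fin F.ρ) (Fin F.ρ) ℝ := LinearMap.toMatrix' (F.lam ∘ₗ F.Ψ β)

/-- The constant part `A` and the slope `B` of `M(β) = A - β B`. -/
def matA : Matrix (Fin F.ρ) (Fin F.ρ) ℝ :=
  LinearMap.toMatrix' (F.lam ∘ₗ (L₀ ∘ₗ Fintype.linearCombination ℝ F.v))

/-- The slope `B` of `M(β) = A - β B`. -/
def matB : Matrix (Fin F.ρ) (Fin F.ρ) ℝ :=
  LinearMap.toMatrix' (F.lam ∘ₗ (L₁ ∘ₗ Fintype.linearCombination ℝ F.v))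

/-- `M(β) = A - β • B` (affine in `β`). -/
theorem mat_eq (β : ℝ) : F.mat β = F.matA - β • F.matB := by
  rw [mat, Ψ_eq, LinearMap.comp_sub, LinearMap.comp_smul, map_sub, map_smul]
  rfl

/-- `M(β₀) = 1`. -/
theorem mat_self : F.mat β₀ = 1 := by
  rw [mat, Ψ, F.lam_comp, LinearMap.toMatrix'_id]

/-- `β ↦ M(β)` is continuous. -/
theorem continuous_mat : Continuous F.mat := by
  have h : F.mat = fun β => F.matA - β • F.matB := funext F.mat_eq
  rw [h]
  exact continuous_const.sub (continuous_id.smul continuous_const)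

/-- `lam (Ψ β c) = M(β) c`. -/
theorem lam_Ψ (β : ℝ) (c : Fin F.ρ → ℝ) : F.lam (F.Ψ β c) = F.mat β *ᵥ c := by
  rw [mat, ← Matrix.toLin'_apply, Matrix.toLin'_toMatrix']
  rfl

/-- **Where `det M(β) ≠ 0`, `Ψ β` is injective.** -/
theorem Ψ_injective {β : ℝ} (hβ : (F.mat β).det ≠ 0) : Function.Injective (F.Ψ β) := by
  intro c₁ c₂ h
  have h1 : F.mat β *ᵥ c₁ = F.mat β *ᵥ c₂ := by rw [← lam_Ψ, ← lam_Ψ, h]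
  have hU : IsUnit (F.mat β).det := isUnit_iff_ne_zero.2 hβ
  have h2 := congrArg (fun w => (F.mat β)⁻¹ *ᵥ w) h1
  simp only [Matrix.mulVec_mulVec, Matrix.nonsing_inv_mul _ hU, Matrix.one_mulVec] at h2
  exact h2

/-- **The regulariser** `g i β = Ψ β ((M β)⁻¹ e_i)` (columns of the inverse transported by the
frame) and the coordinate functionals `π i = (lam ·) i`. -/
def g (i : Fin F.ρ) (β : ℝ) : E := F.Ψ β fun j => (F.mat β)⁻¹ j i

/-- The coordinate functionals `π i x = (lam x) i`. -/
def π (i : Fin F.ρ) : E →ₗ[ℝ] ℝ := (LinearMap.proj i) ∘ₗ F.lam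

/-- `π i` evaluated. -/
theorem π_apply (i : Fin F.ρ) (x : E) : F.π i x = F.lam x i := rfl

/-- `Σ_i π_i(x) g_i(β) = Ψ β ((M β)⁻¹ (lam x))`. -/
theorem sum_π_smul_g (β : ℝ) (x : E) :
    ∑ i, F.π i x • F.g i β = F.Ψ β ((F.mat β)⁻¹ *ᵥ F.lam x) := by
  simp only [g, π_apply, ← map_smul, ← map_sum]
  congr 1
  funext j
  simp only [Finset.sum_apply, Pi.smul_apply, smul_eq_mul, Matrix.mulVec, dotProduct]
  exact Finset.sum_congr rfl fun i _ => mul_comm _ _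

/-- `g i β₀ ∈ R(β₀)`. -/
theorem g_self_mem (i : Fin F.ρ) : F.g i β₀ ∈ pencilRange L₀ L₁ β₀ :=
  F.range_Ψ_le β₀ (LinearMap.mem_range_self _ _)

/-- `β ↦ (M β)⁻¹` is continuous at `β₀` (`det M(β₀) = 1`). -/
theorem continuousAt_mat_inv : ContinuousAt (fun β => (F.mat β)⁻¹) β₀ := by
  have hdet : ContinuousAt (fun β => (F.mat β).det) β₀ := F.continuous_mat.matrix_det.continuousAt
  have hne : (F.mat β₀).det ≠ 0 := by rw [F.mat_self, Matrix.det_one]; exact one_ne_zero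
  have hadj : ContinuousAt (fun β => (F.mat β).adjugate) β₀ := F.continuous_mat.matrix_adjugate.continuousAt
  have h : (fun β => (F.mat β)⁻¹) = fun β => ((F.mat β).det)⁻¹ • (F.mat β).adjugate := by
    funext β
    rw [Matrix.inv_def, Ring.inverse_eq_inv']
  rw [h]
  exact (hdet.inv₀ hne).smul hadj

/-- ★ **The regulariser is continuous at `β₀` against every linear functional.** -/
theorem continuousAt_apply_g (φ : E →ₗ[ℝ] ℝ) (i : Fin F.ρ) :
    ContinuousAt (fun β => φ (F.g i β)) β₀ := by
  have hform : ∀ β, φ (F.g i β) =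
      ∑ j, (F.mat β)⁻¹ j i * (φ (L₀ (F.v j)) - β * φ (L₁ (F.v j))) := by
    intro β
    rw [g, Ψ, LinearMap.comp_apply, Fintype.linearCombination_apply, map_sum, map_sum]
    refine Finset.sum_congr rfl fun j _ => ?_
    rw [map_smul, map_smul, smul_eq_mul, LinearMap.sub_apply, LinearMap.smul_apply, map_sub,
      map_smul, smul_eq_mul]
  simp_rw [hform]
  refine tendsto_finsetSum _ fun j _ => ?_
  have h1 : ContinuousAt (fun β => (F.mat β)⁻¹ j i) β₀ :=
    ((continuous_id.matrix_elem j i).continuousAt).comp F.continuousAt_mat_inv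
  have h2 : ContinuousAt (fun β : ℝ => φ (L₀ (F.v j)) - β * φ (L₁ (F.v j))) β₀ :=
    (continuous_const.sub (continuous_id.mul continuous_const)).continuousAt
  exact h1.mul h2

/-- `det M(β) ≠ 0` near `β₀`. -/
theorem eventually_det_ne_zero : ∀ᶠ β in 𝓝 β₀, (F.mat β).det ≠ 0 := by
  have hdet : ContinuousAt (fun β => (F.mat β).det) β₀ := F.continuous_mat.matrix_det.continuousAt
  have h1 : (F.mat β₀).det = 1 := by rw [F.mat_self, Matrix.det_one]
  have h := hdet.eventually (isOpen_ne.mem_nhds (show (fun β => (F.mat β).det) β₀ ≠ 0 by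
    simp only [h1]; exact one_ne_zero))
  exact h

/-! ### The determinant of the transported frame is a polynomial in `β` -/

/-- The pencil matrix `A - X • B` over `ℝ[X]`. -/
def polyMat : Matrix (Fin F.ρ) (Fin F.ρ) ℝ[X] :=
  F.matA.map Polynomial.C - (Polynomial.X : ℝ[X]) • F.matB.map Polynomial.C

/-- Evaluating the pencil matrix at `β` gives `M(β)`. -/
theorem eval_polyMat (β : ℝ) : (Polynomial.evalRingHom β).mapMatrix F.polyMat = F.mat β := by
  rw [mat_eq]
  ext i j
  simp only [polyMat, RingHom.mapMatrix_apply, Matrix.map_apply, Matrix.sub_apply,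
    Matrix.smul_apply, smul_eq_mul, map_sub, Polynomial.coe_evalRingHom, Polynomial.eval_C,
    Polynomial.eval_mul, Polynomial.eval_X]

/-- `det M(β)` is the evaluation of the polynomial `det (A - X B)`. -/
theorem det_mat_eq_eval (β : ℝ) : (F.mat β).det = (F.polyMat.det).eval β := by
  rw [← eval_polyMat, ← Polynomial.coe_evalRingHom, RingHom.map_det]

/-- The determinant polynomial is non-zero (it is `1` at `β₀`). -/
theorem det_polyMat_ne_zero : F.polyMat.det ≠ 0 := by
  intro h
  have h1 : (F.mat β₀).det = 1 := by rw [F.mat_self, Matrix.det_one]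
  rw [det_mat_eq_eval, h, Polynomial.eval_zero] at h1
  exact zero_ne_one h1

/-- **`det M(β) ≠ 0` off a finite set.** -/
theorem finite_setOf_det_eq_zero : {β : ℝ | (F.mat β).det = 0}.Finite := by
  refine (Polynomial.finite_setOf_isRoot F.det_polyMat_ne_zero).subset fun β hβ => ?_
  simp only [Set.mem_setOf_eq] at hβ ⊢
  rw [Polynomial.IsRoot, ← det_mat_eq_eval]
  exact hβ

end Frame

/-! ## Finite-dimensional source: maximal rank, generic rank, the regulariser -/

section FD

variable [FiniteDimensional ℝ M]

variable (L₀ L₁) in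
/-- Each `R(β)` is finite-dimensional. -/
instance finiteDimensional_pencilRange (β : ℝ) : FiniteDimensional ℝ (pencilRange L₀ L₁ β) := by
  unfold pencilRange; infer_instance

variable (L₀ L₁) in
/-- `dim R(β) ≤ dim M`. -/
theorem finrank_pencilRange_le (β : ℝ) :
    Module.finrank ℝ (pencilRange L₀ L₁ β) ≤ Module.finrank ℝ M :=
  LinearMap.finrank_range_le _

variable (L₀ L₁) in
/-- The dimensions are bounded by `dim M`. -/
theorem bddAbove_range_finrank :
    BddAbove (Set.range fun β : ℝ => Module.finrank ℝ (pencilRange L₀ L₁ β)) :=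
  ⟨Module.finrank ℝ M, by rintro _ ⟨β, rfl⟩; exact finrank_pencilRange_le L₀ L₁ β⟩

variable (L₀ L₁) in
/-- `dim R(β) ≤ maxRank`. -/
theorem finrank_le_maxRank (β : ℝ) : Module.finrank ℝ (pencilRange L₀ L₁ β) ≤ maxRank L₀ L₁ :=
  le_csSup (bddAbove_range_finrank L₀ L₁) ⟨β, rfl⟩

variable (L₀ L₁) in
/-- **The maximal dimension is attained.** -/
theorem exists_finrank_eq_maxRank : ∃ β : ℝ, Module.finrank ℝ (pencilRange L₀ L₁ β) = maxRank L₀ L₁ := by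
  have h := Nat.sSup_mem (Set.range_nonempty fun β : ℝ => Module.finrank ℝ (pencilRange L₀ L₁ β))
    (bddAbove_range_finrank L₀ L₁)
  obtain ⟨β, hβ⟩ := Set.mem_range.1 h
  exact ⟨β, hβ⟩

namespace Frame

variable {β₀ : ℝ} (F : Frame L₀ L₁ β₀)

/-- **Where `det M(β) ≠ 0` and `dim R(β) ≤ ρ`, the frame spans: `range (Ψ β) = R(β)`.** -/
theorem range_Ψ_eq {β : ℝ} (hβ : (F.mat β).det ≠ 0)
    (hle : Module.finrank ℝ (pencilRange L₀ L₁ β) ≤ F.ρ) :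
    LinearMap.range (F.Ψ β) = pencilRange L₀ L₁ β := by
  refine Submodule.eq_of_le_of_finrank_le (F.range_Ψ_le β) ?_
  have h : Module.finrank ℝ (LinearMap.range (F.Ψ β)) = F.ρ := by
    rw [LinearMap.finrank_range_of_inj (F.Ψ_injective hβ)]
    simp
  rw [h]
  exact hle

/-- ★ **On `R(β)` the regulariser is the identity** (where `det M(β) ≠ 0` and `dim R(β) ≤ ρ`). -/
theorem sum_π_smul_g_eq_self {β : ℝ} (hβ : (F.mat β).det ≠ 0)
    (hle : Module.finrank ℝ (pencilRange L₀ L₁ β) ≤ F.ρ) {x : E} (hx : x ∈ pencilRange L₀ L₁ β) :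
    ∑ i, F.π i x • F.g i β = x := by
  rw [← F.range_Ψ_eq hβ hle] at hx
  obtain ⟨c, rfl⟩ := LinearMap.mem_range.1 hx
  rw [sum_π_smul_g, lam_Ψ, Matrix.mulVec_mulVec, Matrix.nonsing_inv_mul _ (isUnit_iff_ne_zero.2 hβ),
    Matrix.one_mulVec]

end Frame

/-- **A frame exists at every `β₀`.** -/
theorem exists_frame (β₀ : ℝ) : Nonempty (Frame L₀ L₁ β₀) := by
  set W := pencilRange L₀ L₁ β₀ with hW
  let b := Module.finBasis ℝ W
  have hv : ∀ i, ∃ v : M, (L₀ - β₀ • L₁) v = (b i : E) := fun i => LinearMap.mem_range.1 (b i).2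
  choose v hv using hv
  set Ψ₀ : (Fin (Module.finrank ℝ W) → ℝ) →ₗ[ℝ] E := (L₀ - β₀ • L₁) ∘ₗ Fintype.linearCombination ℝ v
    with hΨ₀
  have hΨ₀eq : Ψ₀ = W.subtype ∘ₗ (b.equivFun.symm : (Fin (Module.finrank ℝ W) → ℝ) →ₗ[ℝ] W) := by
    apply LinearMap.ext
    intro c
    rw [hΨ₀, LinearMap.comp_apply, Fintype.linearCombination_apply, map_sum, LinearMap.comp_apply,
      LinearEquiv.coe_coe, Module.Basis.equivFun_symm_apply, map_sum]
    refine Finset.sum_congr rfl fun i _ => ?_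
    rw [map_smul, hv i, map_smul, Submodule.subtype_apply]
  have hinj : Function.Injective Ψ₀ := by
    rw [hΨ₀eq]
    exact W.subtype_injective.comp b.equivFun.symm.injective
  obtain ⟨lam, hlam⟩ := LinearMap.exists_leftInverse_of_injective Ψ₀ (LinearMap.ker_eq_bot.2 hinj)
  exact ⟨{ ρ := Module.finrank ℝ W, v := v, lam := lam, finrank_eq := rfl, lam_comp := hlam }⟩

/-- ★★ **Generic dimension off a finite set**: `dim R(β) = maxRank` for all but finitely many
`β`. [folklore] -/
theorem finite_setOf_finrank_ne_maxRank :
    {β : ℝ | Module.finrank ℝ (pencilRange L₀ L₁ β) ≠ maxRank L₀ L₁}.Finite := by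
  obtain ⟨β₁, hβ₁⟩ := exists_finrank_eq_maxRank L₀ L₁
  obtain ⟨F⟩ := exists_frame (L₀ := L₀) (L₁ := L₁) β₁
  refine F.finite_setOf_det_eq_zero.subset fun β hβ => ?_
  simp only [Set.mem_setOf_eq] at hβ ⊢
  by_contra hdet
  apply hβ
  refine le_antisymm (finrank_le_maxRank L₀ L₁ β) ?_
  have h := Submodule.finrank_mono (F.range_Ψ_le β)
  rw [LinearMap.finrank_range_of_inj (F.Ψ_injective hdet)] at h
  simp only [Module.finrank_fintype_fun_eq_card, Fintype.card_fin] at h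
  rw [← hβ₁, F.finrank_eq]
  exact h

/-- ★★ **A regulariser at every point of maximal dimension**: finitely many linear functionals
`π_i` and curves `g_i` with `Σ_i π_i(x) g_i(β) = x` on `R(β)` for `β` near `β₀`, `g_i(β₀) ∈ R(β₀)`,
and `β ↦ φ (g_i β)` continuous at `β₀` for every linear `φ` — the "regular rows" hypothesis of
`ConicStability.inner_semicontinuous`. [folklore] -/
theorem exists_regulariser {β₀ : ℝ} (hβ₀ : Module.finrank ℝ (pencilRange L₀ L₁ β₀) = maxRank L₀ L₁) :
    ∃ (s : ℕ) (π : Fin s → (E →ₗ[ℝ] ℝ)) (g : Fin s → ℝ → E),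
      (∀ᶠ β in 𝓝 β₀, ∀ x ∈ pencilRange L₀ L₁ β, ∑ i, π i x • g i β = x) ∧
      (∀ i, g i β₀ ∈ pencilRange L₀ L₁ β₀) ∧
      ∀ (φ : E →ₗ[ℝ] ℝ) (i : Fin s), ContinuousAt (fun β => φ (g i β)) β₀ := by
  obtain ⟨F⟩ := exists_frame (L₀ := L₀) (L₁ := L₁) β₀
  refine ⟨F.ρ, F.π, F.g, ?_, F.g_self_mem, F.continuousAt_apply_g⟩
  filter_upwards [F.eventually_det_ne_zero] with β hβ x hx
  exact F.sum_π_smul_g_eq_self hβ (by rw [← F.finrank_eq, hβ₀]; exact finrank_le_maxRank L₀ L₁ β) hx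

end FD

end Summit.QuantumFields.GaugeBoot.RowPencil

end
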